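import Mathlib
import Summits.ValiantsHypothesis.ValiantsHypothesis.Theorems.BarrierLeverPartitionMinorsHitByVPHiddenStatesBallCutThirdShellReduction

/-!
# Route BarrierLever — item `PartitionMinorsHitByVP` (stmt-ValiantsHypothesis-19717), line `hidden-states`:
# ★★ THIRD SHELL — THE LEVEL-BOUNDED REDUCTION: `S₃` at all levels `t ≤ T` ⟸ the totally unbalanced cores at levels `t ≤ T`

Helper file (`--supports stmt-ValiantsHypothesis-19717`; cell valiant-natproofs, 𝒟-side door (c), registered line
`Cruxes/PartitionMinorsHitByVP/Lines/hidden_states.lean` v10; prover seat val-np-p6 gen 22).  Closes NO item; definition-free.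

THE POINT.  `exists_table_threeSwap_of_unbalanced` (val-np-p6 g21, `…BallCutThirdShellReduction`) needs its hypothesis at EVERY level `t`,
but its induction only ever LOWERS the level (a coordinate lying in all three `A_l` and all three `C_l` is cut to a 3-swap family one level
down; every other step keeps `t`).  This file records the same induction with the hypothesis restricted to `t ≤ T`
(`served_threeSwap_on_of_unbalanced_le`, ★★ `exists_table_threeSwap_of_unbalanced_le`), so that finite data closes finite ranges:
with the whole t = 2 chart in the kernel (`…ThirdShellLevel2Classes`, val-np-p6 g22: all 493 classes) and t = 1 (every family served),
**«`S₃` at every `t ≤ 2`, for every `h`» now hinges on exactly one missing theorem: the CLASSIFICATION** (every totally unbalanced 3-swap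
family at `t = 2` is, up to a permutation of the coordinates and a relabelling of the swaps, one of the 493 coded classes).

HONEST LABEL: a reduction inside the conjecture column; 19717 stays OPEN; nothing on crux 14610 or VP ≠ VNP.
-/

set_option linter.dupNamespace false

namespace Summit.ValiantsHypothesis.ValiantsHypothesis.Theorems.BarrierLever.HiddenStates

open Finset

noncomputable section

namespace BallCut

open SymbJoin

variable {h : ℕ}

/-- **Every 3-swap family of level `t ≤ T` inside `S` is served on `S`, given that the totally unbalanced ones of levels `≤ T` are served**
(the induction of `served_threeSwap_on_of_unbalanced` with a level bound threaded through). -/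
theorem served_threeSwap_on_of_unbalanced_le (T : ℕ)
    (H : ∀ (n t : ℕ) (A C : Fin 3 → Finset (Fin n)), t ≤ T → (∀ l, (A l).card = t) → (∀ l, (C l).card = t + 1) →
      Function.Injective A → Function.Injective C → (∀ l l', ¬ A l ⊆ C l') →
      (∀ x : Fin n, (Finset.univ.filter fun l => x ∈ A l).card ≠ (Finset.univ.filter fun l => x ∈ C l).card) →
      ∀ ⦃r : ℕ⦄ (u cols : Fin r → Finset (Fin n)), Function.Injective u →
        (∀ i, ((u i).card ≤ t ∧ ∀ l, u i ≠ A l) ∨ ∃ l, u i = C l) →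
        (∀ J : Finset (Fin n), J.card ≤ t → ∃ kk, cols kk = J) →
        ∃ tx : Option (Fin n) → Fin n → ℂ,
          (Matrix.of fun i kk : Fin r => ∏ a ∈ u i, (tx none a + ∑ q ∈ cols kk, tx (some q) a)).det ≠ 0)
    (n : ℕ) : ∀ (S : Finset (Fin h)), S.card = n → ∀ (t : ℕ), t ≤ T → ∀ (A C : Fin 3 → Finset (Fin h)),
      (∀ l, (A l).card = t) → (∀ l, (C l).card = t + 1) → Function.Injective A → Function.Injective C →
      (∀ l l', ¬ A l ⊆ C l') → (∀ l, A l ⊆ S) → (∀ l, C l ⊆ S) →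
      ∀ ⦃r : ℕ⦄ (u cols : Fin r → Finset (Fin h)), Function.Injective u → Function.Injective cols →
        (∀ U, (∃ i, u i = U) ↔ ((U ⊆ S ∧ U.card ≤ t ∧ ∀ l, U ≠ A l) ∨ ∃ l, U = C l)) →
        (∀ J, (∃ kk, cols kk = J) ↔ (J ⊆ S ∧ J.card ≤ t)) →
        symDet u (fun kk => ((0 : Fin 1), cols kk)) ≠ 0 := by
  classical
  induction n with
  | zero =>
    intro S hS t htT A C hA hC hAi hCi hAC hAS hCS r u cols hu hcinj hU hJ
    have hA0 : ∀ l, A l = ∅ := fun l => Finset.subset_empty.1 (by rw [← Finset.card_eq_zero.1 hS]; exact hAS l)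
    exact absurd (hAi ((hA0 0).trans (hA0 1).symm)) (by decide)
  | succ n ih =>
    intro S hS t htT A C hA hC hAi hCi hAC hAS hCS r u cols hu hcinj hU hJ
    by_cases hbal : ∃ x ∈ S, (Finset.univ.filter fun l => x ∈ A l).card = (Finset.univ.filter fun l => x ∈ C l).card
    · obtain ⟨x, hxS, hx⟩ := hbal
      have hS' : (S.erase x).card = n := by rw [Finset.card_erase_of_mem hxS, hS]; rfl
      obtain ⟨k, hk⟩ : ∃ k, (Finset.univ.filter fun l => x ∈ A l).card = k := ⟨_, rfl⟩
      have hkC : (Finset.univ.filter fun l => x ∈ C l).card = k := by rw [← hx]; exact hk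
      have hk3 : k ≤ 3 := by
        have := Finset.card_filter_le (Finset.univ : Finset (Fin 3)) (fun l => x ∈ A l)
        rw [hk] at this; simpa using this
      rcases (by omega : k = 0 ∨ k = 3 ∨ (k = 1 ∨ k = 2)) with hk0 | hk3' | hk12
      · -- `k = 0`: `x` is free
        have hxA : ∀ l, x ∉ A l := by
          have hE := Finset.card_eq_zero.1 (hk.trans hk0)
          intro l hl
          exact (Finset.filter_eq_empty_iff.1 hE) (Finset.mem_univ l) hl
        have hxC : ∀ l, x ∉ C l := by
          have hE := Finset.card_eq_zero.1 (hkC.trans hk0)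
          intro l hl
          exact (Finset.filter_eq_empty_iff.1 hE) (Finset.mem_univ l) hl
        have hAS' : ∀ l, A l ⊆ S.erase x := fun l a ha => Finset.mem_erase.2 ⟨fun hax => hxA l (hax ▸ ha), hAS l ha⟩
        have hCS' : ∀ l, C l ⊆ S.erase x := fun l a ha => Finset.mem_erase.2 ⟨fun hax => hxC l (hax ▸ ha), hCS l ha⟩
        exact served_of_erase_free t A C hA hC hAi hCi S x hAS' hCS'
          (ih (S.erase x) hS' t htT A C hA hC hAi hCi hAC hAS' hCS') u cols hu hcinj hU hJ
      · -- `k = 3`: every swap passes through `x`; the link is a 3-swap family one level down, the deletion is the ball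
        have hxA : ∀ l, x ∈ A l := by
          have hfull : (Finset.univ.filter fun l => x ∈ A l) = Finset.univ :=
            Finset.eq_univ_of_card _ (by rw [hk, hk3']; simp)
          intro l; have := hfull ▸ Finset.mem_univ l; exact (Finset.mem_filter.1 this).2
        have hxC : ∀ l, x ∈ C l := by
          have hfull : (Finset.univ.filter fun l => x ∈ C l) = Finset.univ :=
            Finset.eq_univ_of_card _ (by rw [hkC, hk3']; simp)
          intro l; have := hfull ▸ Finset.mem_univ l; exact (Finset.mem_filter.1 this).2
        obtain ⟨t', rfl⟩ : ∃ t', t = t' + 1 :=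
          ⟨t - 1, by have := Finset.card_pos.2 ⟨x, hxA 0⟩; rw [hA 0] at this; omega⟩
        -- the link family
        let A' : Fin 3 → Finset (Fin h) := fun l => (A l).erase x
        let C' : Fin 3 → Finset (Fin h) := fun l => (C l).erase x
        have hA' : ∀ l, (A' l).card = t' := fun l => by
          have := Finset.card_erase_of_mem (hxA l); simp only [A']; rw [this, hA]; rfl
        have hC' : ∀ l, (C' l).card = t' + 1 := fun l => by
          have := Finset.card_erase_of_mem (hxC l); simp only [C']; rw [this, hC]; rfl
        have hA'i : Function.Injective A' := by
          intro l l' hll'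
          have h1 : A l = A l' := by
            rw [← Finset.insert_erase (hxA l), ← Finset.insert_erase (hxA l')]; exact congrArg _ hll'
          exact hAi h1
        have hC'i : Function.Injective C' := by
          intro l l' hll'
          have h1 : C l = C l' := by
            rw [← Finset.insert_erase (hxC l), ← Finset.insert_erase (hxC l')]; exact congrArg _ hll'
          exact hCi h1
        have hA'C' : ∀ l l', ¬ A' l ⊆ C' l' := fun l l' hsub => hAC l l' (by
          rw [← Finset.insert_erase (hxA l), ← Finset.insert_erase (hxC l')]
          exact Finset.insert_subset_insert x hsub)
        have hA'S : ∀ l, A' l ⊆ S.erase x := fun l => Finset.erase_subset_erase x (hAS l)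
        have hC'S : ∀ l, C' l ⊆ S.erase x := fun l => Finset.erase_subset_erase x (hCS l)
        refine served_of_erase_balanced t' A C hA hC hAi hCi S x hxS hAS hx ?_ ?_ u cols hu hcinj hU hJ
        · -- Hlink from the induction hypothesis
          intro r' u' cols' hu' hc' hU' hJ'
          refine ih (S.erase x) hS' t' (by omega) A' C' hA' hC' hA'i hC'i hA'C' hA'S hC'S u' cols' hu' hc' (fun U => ?_) hJ'
          rw [hU' U]
          rw [show (∀ l, x ∈ A l → U ≠ (A l).erase x) ↔ ∀ l, U ≠ A' l from ⟨fun H' l => H' l (hxA l), fun H' l _ => H' l⟩,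
            show (∃ l, x ∈ C l ∧ U = (C l).erase x) ↔ ∃ l, U = C' l from
              ⟨fun ⟨l, _, hl⟩ => ⟨l, hl⟩, fun ⟨l, hl⟩ => ⟨l, hxC l, hl⟩⟩]
        · -- Hdel: the ball `B_{t'+1}(S.erase x)`
          intro r' u' cols' hu' hc' hU' hJ'
          refine symGood_ball u' cols' hu' fun U => ?_
          rw [hU' U, hJ' U]
          constructor
          · rintro (⟨h1, h2, -⟩ | ⟨l, hl, -⟩)
            · exact ⟨h1, h2⟩
            · exact absurd (hxC l) hl
          · rintro ⟨h1, h2⟩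
            exact Or.inl ⟨h1, h2, fun l hl => absurd (hxA l) hl⟩
      · -- `k ∈ {1, 2}`: balanced cut with the landed first and second shells
        have hne : (Finset.univ.filter fun l => x ∈ A l).Nonempty := by
          rw [← Finset.card_pos]; rcases hk12 with h1 | h2 <;> omega
        obtain ⟨l₀, hl₀⟩ := hne
        have hxl₀ : x ∈ A l₀ := (Finset.mem_filter.1 hl₀).2
        obtain ⟨t', rfl⟩ : ∃ t', t = t' + 1 :=
          ⟨t - 1, by have := Finset.card_pos.2 ⟨x, hxl₀⟩; rw [hA l₀] at this; omega⟩
        refine served_of_erase_balanced t' A C hA hC hAi hCi S x hxS hAS hx ?_ ?_ u cols hu hcinj hU hJ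
        · -- THE LINK: the `k` swaps through `x`, `x` erased, level `t'`
          intro r' u' cols' hu' hc' hU' hJ'
          let eA : Fin k ↪o Fin 3 := (Finset.univ.filter fun l : Fin 3 => x ∈ A l).orderEmbOfFin hk
          let eC : Fin k ↪o Fin 3 := (Finset.univ.filter fun l : Fin 3 => x ∈ C l).orderEmbOfFin hkC
          have heA : ∀ j, x ∈ A (eA j) := fun j => by
            have hm : eA j ∈ Finset.univ.filter (fun l : Fin 3 => x ∈ A l) := Finset.orderEmbOfFin_mem _ hk j
            exact (Finset.mem_filter.1 hm).2
          have heC : ∀ j, x ∈ C (eC j) := fun j => by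
            have hm : eC j ∈ Finset.univ.filter (fun l : Fin 3 => x ∈ C l) := Finset.orderEmbOfFin_mem _ hkC j
            exact (Finset.mem_filter.1 hm).2
          have heAsur : ∀ l, x ∈ A l → ∃ j, eA j = l := fun l hl => by
            have : l ∈ Set.range eA := by
              rw [show Set.range eA = ↑(Finset.univ.filter fun l : Fin 3 => x ∈ A l) from
                Finset.range_orderEmbOfFin _ hk]; simp [hl]
            exact this
          have heCsur : ∀ l, x ∈ C l → ∃ j, eC j = l := fun l hl => by
            have : l ∈ Set.range eC := by
              rw [show Set.range eC = ↑(Finset.univ.filter fun l : Fin 3 => x ∈ C l) from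
                Finset.range_orderEmbOfFin _ hkC]; simp [hl]
            exact this
          let A₁ : Fin k → Finset (Fin h) := fun j => (A (eA j)).erase x
          let C₁ : Fin k → Finset (Fin h) := fun j => (C (eC j)).erase x
          have hA₁ : ∀ j, (A₁ j).card = t' := fun j => by
            have := Finset.card_erase_of_mem (heA j); simp only [A₁]; rw [this, hA]; rfl
          have hC₁ : ∀ j, (C₁ j).card = t' + 1 := fun j => by
            have := Finset.card_erase_of_mem (heC j); simp only [C₁]; rw [this, hC]; rfl
          have hA₁i : Function.Injective A₁ := by
            intro j j' hjj'
            have h1 : A (eA j) = A (eA j') := by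
              rw [← Finset.insert_erase (heA j), ← Finset.insert_erase (heA j')]; exact congrArg _ hjj'
            exact eA.injective (hAi h1)
          have hC₁i : Function.Injective C₁ := by
            intro j j' hjj'
            have h1 : C (eC j) = C (eC j') := by
              rw [← Finset.insert_erase (heC j), ← Finset.insert_erase (heC j')]; exact congrArg _ hjj'
            exact eC.injective (hCi h1)
          have hA₁C₁ : ∀ j j', ¬ A₁ j ⊆ C₁ j' := fun j j' hsub => hAC (eA j) (eC j') (by
            rw [← Finset.insert_erase (heA j), ← Finset.insert_erase (heC j')]
            exact Finset.insert_subset_insert x hsub)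
          refine served_small_on t' (S.erase x) hk12 A₁ C₁ hA₁ hC₁ hA₁i hC₁i hA₁C₁
            (fun j => Finset.erase_subset_erase x (hAS _)) (fun j => Finset.erase_subset_erase x (hCS _))
            u' cols' hu' (fun U => ?_) hJ'
          rw [hU' U]
          have e1 : (∀ l, x ∈ A l → U ≠ (A l).erase x) ↔ ∀ j, U ≠ A₁ j := by
            constructor
            · intro H' j; exact H' (eA j) (heA j)
            · intro H' l hl; obtain ⟨j, rfl⟩ := heAsur l hl; exact H' j
          have e2 : (∃ l, x ∈ C l ∧ U = (C l).erase x) ↔ ∃ j, U = C₁ j := by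
            constructor
            · rintro ⟨l, hl, hU''⟩; obtain ⟨j, rfl⟩ := heCsur l hl; exact ⟨j, hU''⟩
            · rintro ⟨j, hU''⟩; exact ⟨eC j, heC j, hU''⟩
          rw [e1, e2]
        · -- THE DELETION: the `3 - k` swaps avoiding `x`, level `t' + 1`
          intro r' u' cols' hu' hc' hU' hJ'
          obtain ⟨k', hk'⟩ : ∃ k', (Finset.univ.filter fun l : Fin 3 => x ∉ A l).card = k' := ⟨_, rfl⟩
          have hk3'' : k + k' = 3 := by
            have := Finset.card_filter_add_card_filter_not (s := (Finset.univ : Finset (Fin 3))) (fun l => x ∈ A l)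
            rw [hk, hk'] at this; simpa using this
          have hICk : (Finset.univ.filter fun l : Fin 3 => x ∉ C l).card = k' := by
            have := Finset.card_filter_add_card_filter_not (s := (Finset.univ : Finset (Fin 3))) (fun l => x ∈ C l)
            rw [hkC] at this
            simp only [Finset.card_univ, Fintype.card_fin] at this
            omega
          have hkk : k' = 1 ∨ k' = 2 := by rcases hk12 with h1 | h2 <;> omega
          let eA : Fin k' ↪o Fin 3 := (Finset.univ.filter fun l : Fin 3 => x ∉ A l).orderEmbOfFin hk'
          let eC : Fin k' ↪o Fin 3 := (Finset.univ.filter fun l : Fin 3 => x ∉ C l).orderEmbOfFin hICk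
          have heA : ∀ j, x ∉ A (eA j) := fun j => by
            have hm : eA j ∈ Finset.univ.filter (fun l : Fin 3 => x ∉ A l) := Finset.orderEmbOfFin_mem _ hk' j
            exact (Finset.mem_filter.1 hm).2
          have heC : ∀ j, x ∉ C (eC j) := fun j => by
            have hm : eC j ∈ Finset.univ.filter (fun l : Fin 3 => x ∉ C l) := Finset.orderEmbOfFin_mem _ hICk j
            exact (Finset.mem_filter.1 hm).2
          have heAsur : ∀ l, x ∉ A l → ∃ j, eA j = l := fun l hl => by
            have : l ∈ Set.range eA := by
              rw [show Set.range eA = ↑(Finset.univ.filter fun l : Fin 3 => x ∉ A l) from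
                Finset.range_orderEmbOfFin _ hk']; simp [hl]
            exact this
          have heCsur : ∀ l, x ∉ C l → ∃ j, eC j = l := fun l hl => by
            have : l ∈ Set.range eC := by
              rw [show Set.range eC = ↑(Finset.univ.filter fun l : Fin 3 => x ∉ C l) from
                Finset.range_orderEmbOfFin _ hICk]; simp [hl]
            exact this
          let A₂ : Fin k' → Finset (Fin h) := fun j => A (eA j)
          let C₂ : Fin k' → Finset (Fin h) := fun j => C (eC j)
          refine served_small_on (t' + 1) (S.erase x) hkk A₂ C₂ (fun j => hA _) (fun j => hC _)
            (fun j j' hjj' => eA.injective (hAi hjj')) (fun j j' hjj' => eC.injective (hCi hjj'))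
            (fun j j' => hAC _ _)
            (fun j a ha => Finset.mem_erase.2 ⟨fun hax => heA j (hax ▸ ha), hAS _ ha⟩)
            (fun j a ha => Finset.mem_erase.2 ⟨fun hax => heC j (hax ▸ ha), hCS _ ha⟩)
            u' cols' hu' (fun U => ?_) hJ'
          rw [hU' U]
          have e1 : (∀ l, x ∉ A l → U ≠ A l) ↔ ∀ j, U ≠ A₂ j := by
            constructor
            · intro H' j; exact H' (eA j) (heA j)
            · intro H' l hl; obtain ⟨j, rfl⟩ := heAsur l hl; exact H' j
          have e2 : (∃ l, x ∉ C l ∧ U = C l) ↔ ∃ j, U = C₂ j := by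
            constructor
            · rintro ⟨l, hl, hU''⟩; obtain ⟨j, rfl⟩ := heCsur l hl; exact ⟨j, hU''⟩
            · rintro ⟨j, hU''⟩; exact ⟨eC j, heC j, hU''⟩
          rw [e1, e2]
    · -- no balanced coordinate in `S`: the family is totally unbalanced with support `S`
      push Not at hbal
      set σ := (S.orderEmbOfFin rfl).toEmbedding with hσ
      let A' : Fin 3 → Finset (Fin S.card) := fun l => (A l).preimage σ σ.injective.injOn
      let C' : Fin 3 → Finset (Fin S.card) := fun l => (C l).preimage σ σ.injective.injOn
      have hA' : ∀ l, (A' l).map σ = A l := fun l => map_preimage_orderEmb S (A l) (hAS l)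
      have hC' : ∀ l, (C' l).map σ = C l := fun l => map_preimage_orderEmb S (C l) (hCS l)
      have hA'c : ∀ l, (A' l).card = t := fun l => by rw [← Finset.card_map σ, hA' l, hA l]
      have hC'c : ∀ l, (C' l).card = t + 1 := fun l => by rw [← Finset.card_map σ, hC' l, hC l]
      have hA'i : Function.Injective A' := fun l l' hll' => hAi (by rw [← hA' l, ← hA' l']; exact congrArg _ hll')
      have hC'i : Function.Injective C' := fun l l' hll' => hCi (by rw [← hC' l, ← hC' l']; exact congrArg _ hll')
      have hA'C' : ∀ l l', ¬ A' l ⊆ C' l' := fun l l' hsub => hAC l l' (by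
        rw [← hA' l, ← hC' l']; exact Finset.map_subset_map.2 hsub)
      have hunb : ∀ y : Fin S.card, (Finset.univ.filter fun l => y ∈ A' l).card ≠
          (Finset.univ.filter fun l => y ∈ C' l).card := by
        intro y
        have hyS : σ y ∈ S := by
          have : σ y ∈ Set.range (S.orderEmbOfFin rfl) := ⟨y, rfl⟩
          rw [Finset.range_orderEmbOfFin] at this; exact this
        have e1 : (Finset.univ.filter fun l => y ∈ A' l) = Finset.univ.filter fun l => σ y ∈ A l := by
          ext l; simp [A', Finset.mem_preimage]
        have e2 : (Finset.univ.filter fun l => y ∈ C' l) = Finset.univ.filter fun l => σ y ∈ C l := by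
          ext l; simp [C', Finset.mem_preimage]
        rw [e1, e2]; exact hbal (σ y) hyS
      refine served_image_of_served S.card t σ A' C' (H S.card t A' C' htT hA'c hC'c hA'i hC'i hA'C' hunb) u cols hu ?_ ?_
      · intro U
        rw [hU U, hσ, map_orderEmb_univ]
        simp only [← hσ, hA', hC']
      · intro J
        rw [hJ J, hσ, map_orderEmb_univ]

/-- ★★ **THIRD SHELL, LEVEL-BOUNDED REDUCTION.**  If every totally unbalanced 3-swap family of level `t ≤ T` is served on its support,
then EVERY 3-swap family of level `t ≤ T` is served, for all `h`. -/
theorem exists_table_threeSwap_of_unbalanced_le (T : ℕ)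
    (H : ∀ (n t : ℕ) (A C : Fin 3 → Finset (Fin n)), t ≤ T → (∀ l, (A l).card = t) → (∀ l, (C l).card = t + 1) →
      Function.Injective A → Function.Injective C → (∀ l l', ¬ A l ⊆ C l') →
      (∀ x : Fin n, (Finset.univ.filter fun l => x ∈ A l).card ≠ (Finset.univ.filter fun l => x ∈ C l).card) →
      ∀ ⦃r : ℕ⦄ (u cols : Fin r → Finset (Fin n)), Function.Injective u →
        (∀ i, ((u i).card ≤ t ∧ ∀ l, u i ≠ A l) ∨ ∃ l, u i = C l) →
        (∀ J : Finset (Fin n), J.card ≤ t → ∃ kk, cols kk = J) →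
        ∃ tx : Option (Fin n) → Fin n → ℂ,
          (Matrix.of fun i kk : Fin r => ∏ a ∈ u i, (tx none a + ∑ q ∈ cols kk, tx (some q) a)).det ≠ 0)
    (h t : ℕ) (ht : t ≤ T) (A C : Fin 3 → Finset (Fin h))
    (hA : ∀ l, (A l).card = t) (hC : ∀ l, (C l).card = t + 1)
    (hAi : Function.Injective A) (hCi : Function.Injective C) (hAC : ∀ l l', ¬ A l ⊆ C l')
    {r : ℕ} (u cols : Fin r → Finset (Fin h)) (hu : Function.Injective u)
    (hU : ∀ i, ((u i).card ≤ t ∧ ∀ l, u i ≠ A l) ∨ ∃ l, u i = C l)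
    (hcols : ∀ J : Finset (Fin h), J.card ≤ t → ∃ kk, cols kk = J) :
    ∃ tx : Option (Fin h) → Fin h → ℂ,
      (Matrix.of fun i kk : Fin r => ∏ a ∈ u i, (tx none a + ∑ q ∈ cols kk, tx (some q) a)).det ≠ 0 := by
  classical
  obtain ⟨hcinj, hUr, hJr⟩ := rigidity t A C hA hC hAi hCi u cols hu hU hcols
  rw [exists_table_iff_symGood]
  exact served_threeSwap_on_of_unbalanced_le T H _ Finset.univ rfl t ht A C hA hC hAi hCi hAC (fun l => Finset.subset_univ _)
    (fun l => Finset.subset_univ _) u cols hu hcinj (fun U => by rw [hUr U]; simp) (fun J => by rw [hJr J]; simp)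

end BallCut

end

end Summit.ValiantsHypothesis.ValiantsHypothesis.Theorems.BarrierLever.HiddenStates
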